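import Summits.Ventures.Crystal3D.Theorems.StickyWulffConstantGenericWallFloorRiserEndRows
import HarnessLib

/-!
# A kernel sphere-covering checker for the riser-end rows R-G2H (`ContactsAtMost`), with soundness
# (crux `GenericWallFloor`, stmt-Ventures-19480, line `WallLedgerG`; cf-p2 R41v — wulff-p2's lineage B′ made kernel-grade)

HONEST FRAMING. Venture `Summits/Ventures/Crystal3D` (cell `crystal3d-full`), helper `--supports` the crux
`GenericWallFloor` of `route-Ventures-StickyWulffConstant`.  Rung credit only; F-C1 not moved.
OBSERVATION: a row `ContactsAtMost 0 (F.image hcpPt) k` of `…RiserEndRows` (19480-p1 g6) with exactly `k` members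
of `F` at distance `1` from the centre is a SINGLE-FREE-BALL problem — an extra contact `y` has `‖y‖ = 1` and
`dist y f ≥ 1` for all `f ∈ hcpPt '' F` — i.e. the unit sphere must be COVERED by the open unit balls around
`hcpPt '' F`.  `y` is covered by `g = hcpPt P` iff the COVER GAP `2⟪y,g⟫ − ‖g‖²‖y‖` is positive; the gap is
positively homogeneous and CONCAVE in `y`, so a rectangle of a face of the cube `[-1,1]³` (central projection) is
covered by `g` as soon as its four corners are, and at an integer corner `v` (dyadic rectangle scaled to integers)
positivity is the integer test `0 < ⟪v,P⟫ ∧ |P|⁴|v|² < 72⟪v,P⟫²` (`cornerOK`).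
CONTENTS: `CoverTree` / `coverTreeCheck` / `coverCheck` (the Boolean checker, integers only) and SOUNDNESS
`sphere_covered_of_coverCheck` (`coverCheck L … = true → ∀ y, ‖y‖ = 1 → ∃ P ∈ L, dist y (hcpPt P) < 1`); the glue to
`ContactsAtMost` and the certified row theorems are in `…RiserEndCoverRowsMin` / `…RiserEndCoverRowsTwo`.
WHAT THIS IS NOT: nothing on the ONE-SIDED rows `RiserEnd_E?_one` (their uncovered set is the finite set of hole
sites — not an open-cover statement); no wall law; F-C1 not moved.
-/

noncomputable section

namespace Summit.Ventures.Crystal3D.Theorems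

open Finset Literature.Geometry.DiscreteGeometry
open scoped RealInnerProductSpace

/-! ### The checker (integers only) -/

/-- Certificate tree for one face rectangle: split the first / the second free coordinate at the midpoint, or
stop at a leaf naming (by index into the obstacle list) one obstacle whose open unit ball covers the rectangle. -/
inductive CoverTree : Type
  | leaf (n : ℕ) : CoverTree
  | splitA (l r : CoverTree) : CoverTree
  | splitB (l r : CoverTree) : CoverTree

/-- Integer dot product on `Fin 3 → ℤ`. -/
def dotZ (v w : Fin 3 → ℤ) : ℤ := v 0 * w 0 + v 1 * w 1 + v 2 * w 2

/-- The integer vector with `c` on axis `i` and `a`, `b` on the two other axes (in increasing order). -/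
def faceVecZ (i : Fin 3) (c a b : ℤ) : Fin 3 → ℤ := ![![c, a, b], ![a, c, b], ![a, b, c]] i

/-- **Corner test**: the direction of the integer vector `v` is covered by the open unit ball around `hcpPt P`
(`0 < ⟪v,P⟫` and `|P|⁴ |v|² < 72 ⟪v,P⟫²`). -/
def cornerOK (v P : Fin 3 → ℤ) : Bool :=
  decide (0 < dotZ v P) && decide (dotZ P P * dotZ P P * dotZ v v < 72 * (dotZ v P * dotZ v P))

/-- **Tree checker** for the rectangle `[a0,a1] × [b0,b1]` at integer scale `D` on the face (axis `i`, sign `s`):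
every leaf names an obstacle of `L` passing the corner test at the four corners of its rectangle; a split doubles
the scale and halves the rectangle. -/
def coverTreeCheck (L : List (Fin 3 → ℤ)) (i : Fin 3) (s : ℤ) : ℤ → ℤ → ℤ → ℤ → ℤ → CoverTree → Bool
  | D, a0, a1, b0, b1, .leaf n =>
      match L[n]? with
      | none => false
      | some P =>
          cornerOK (faceVecZ i (s * D) a0 b0) P && cornerOK (faceVecZ i (s * D) a0 b1) P &&
            cornerOK (faceVecZ i (s * D) a1 b0) P && cornerOK (faceVecZ i (s * D) a1 b1) P
  | D, a0, a1, b0, b1, .splitA l r =>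
      coverTreeCheck L i s (2 * D) (2 * a0) (a0 + a1) (2 * b0) (2 * b1) l &&
        coverTreeCheck L i s (2 * D) (a0 + a1) (2 * a1) (2 * b0) (2 * b1) r
  | D, a0, a1, b0, b1, .splitB l r =>
      coverTreeCheck L i s (2 * D) (2 * a0) (2 * a1) (2 * b0) (b0 + b1) l &&
        coverTreeCheck L i s (2 * D) (2 * a0) (2 * a1) (b0 + b1) (2 * b1) r

/-- **Cover checker**: the six faces `x_i = ±1`, `[-1,1]²` each, with their certificate trees. -/
def coverCheck (L : List (Fin 3 → ℤ)) (t0p t0m t1p t1m t2p t2m : CoverTree) : Bool :=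
  coverTreeCheck L 0 1 1 (-1) 1 (-1) 1 t0p && coverTreeCheck L 0 (-1) 1 (-1) 1 (-1) 1 t0m &&
    coverTreeCheck L 1 1 1 (-1) 1 (-1) 1 t1p && coverTreeCheck L 1 (-1) 1 (-1) 1 (-1) 1 t1m &&
    coverTreeCheck L 2 1 1 (-1) 1 (-1) 1 t2p && coverTreeCheck L 2 (-1) 1 (-1) 1 (-1) 1 t2m

/-! ### Real semantics -/

/-- The real vector with `c` on axis `i` and `a`, `b` on the two other axes (in increasing order). -/
def faceVec (i : Fin 3) (c a b : ℝ) : EuclideanSpace ℝ (Fin 3) :=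
  WithLp.toLp 2 (![![c, a, b], ![a, c, b], ![a, b, c]] i)

/-- The COVER GAP of `x` for the obstacle `P`: `2⟪x, g⟫ − ‖g‖²‖x‖`, `g = hcpPt P`.  It is positive iff the
direction of `x` lies in the open unit ball around `g` (for `‖x‖ = 1`: iff `dist x g < 1`). -/
def coverGap (P : Fin 3 → ℤ) (x : EuclideanSpace ℝ (Fin 3)) : ℝ :=
  2 * ⟪x, hcpPt P⟫ - ‖hcpPt P‖ ^ 2 * ‖x‖

/-- `intVec` of the integer face vector is the real face vector. -/
theorem intVec_faceVecZ (i : Fin 3) (c a b : ℤ) :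
    intVec (faceVecZ i c a b) = faceVec i (c : ℝ) (a : ℝ) (b : ℝ) := by
  ext k
  fin_cases i <;> fin_cases k <;> simp [faceVecZ, faceVec, intVec]

/-- Doubling all entries doubles the face vector. -/
theorem faceVec_two_mul (i : Fin 3) (c a b : ℝ) :
    faceVec i (2 * c) (2 * a) (2 * b) = (2 : ℝ) • faceVec i c a b := by
  ext k
  fin_cases i <;> fin_cases k <;> simp [faceVec] 

/-- The face vector is affine in its first free coordinate. -/
theorem faceVec_segment_a (i : Fin 3) (c a₀ a₁ b t : ℝ) :
    faceVec i c ((1 - t) * a₀ + t * a₁) b = (1 - t) • faceVec i c a₀ b + t • faceVec i c a₁ b := by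
  ext k
  fin_cases i <;> fin_cases k <;> simp [faceVec] <;> ring

/-- The face vector is affine in its second free coordinate. -/
theorem faceVec_segment_b (i : Fin 3) (c a b₀ b₁ t : ℝ) :
    faceVec i c a ((1 - t) * b₀ + t * b₁) = (1 - t) • faceVec i c a b₀ + t • faceVec i c a b₁ := by
  ext k
  fin_cases i <;> fin_cases k <;> simp [faceVec] <;> ring

/-! ### The cover gap: homogeneity, convexity, and the covering it expresses -/

/-- The inner product with an integer vector, in coordinates (local copy of `…ConeCertificateDefs`'s lemma,
which is not in this file's import cone). -/
theorem real_inner_intVec_coords (x : EuclideanSpace ℝ (Fin 3)) (v : Fin 3 → ℤ) :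
    ⟪x, intVec v⟫ = x 0 * v 0 + x 1 * v 1 + x 2 * v 2 := by
  simp [intVec, PiLp.inner_apply, Fin.sum_univ_three, mul_comm]

/-- `‖hcpPt P‖² = |P|²/18`. -/
theorem norm_hcpPt_sq (P : Fin 3 → ℤ) : ‖hcpPt P‖ ^ 2 = (dotZ P P : ℝ) / 18 := by
  have h18 : Real.sqrt 18 ^ 2 = 18 := Real.sq_sqrt (by norm_num)
  rw [hcpPt, norm_smul, mul_pow, norm_inv, Real.norm_of_nonneg (Real.sqrt_nonneg _), inv_pow, h18,
    ← real_inner_self_eq_norm_sq, real_inner_intVec_coords]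
  simp only [intVec_apply, dotZ]
  push_cast
  ring

/-- `⟪x, hcpPt P⟫` in coordinates. -/
theorem inner_hcpPt_right (x : EuclideanSpace ℝ (Fin 3)) (P : Fin 3 → ℤ) :
    ⟪x, hcpPt P⟫ = (Real.sqrt 18)⁻¹ * (x 0 * P 0 + x 1 * P 1 + x 2 * P 2) := by
  rw [hcpPt, real_inner_smul_right, real_inner_intVec_coords]

/-- A UNIT vector with positive cover gap is at distance `< 1` from the obstacle. -/
theorem dist_lt_one_of_coverGap_pos {P : Fin 3 → ℤ} {y : EuclideanSpace ℝ (Fin 3)} (hy : ‖y‖ = 1)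
    (h : 0 < coverGap P y) : dist y (hcpPt P) < 1 := by
  have hsq : dist y (hcpPt P) ^ 2 < 1 := by
    rw [dist_eq_norm, ← real_inner_self_eq_norm_sq, real_inner_sub_sub_self, real_inner_self_eq_norm_sq,
      real_inner_self_eq_norm_sq, hy]
    unfold coverGap at h
    rw [hy, mul_one] at h
    linarith
  have h0 : 0 ≤ dist y (hcpPt P) := dist_nonneg
  nlinarith

/-- Positive homogeneity of the cover gap. -/
theorem coverGap_smul {P : Fin 3 → ℤ} {x : EuclideanSpace ℝ (Fin 3)} {c : ℝ} (hc : 0 ≤ c) :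
    coverGap P (c • x) = c * coverGap P x := by
  unfold coverGap
  rw [norm_smul, Real.norm_of_nonneg hc, real_inner_smul_left]
  ring

/-- Positive homogeneity: the sign of the cover gap is scale invariant. -/
theorem coverGap_pos_smul_iff {P : Fin 3 → ℤ} {x : EuclideanSpace ℝ (Fin 3)} {c : ℝ} (hc : 0 < c) :
    0 < coverGap P (c • x) ↔ 0 < coverGap P x := by
  rw [coverGap_smul hc.le]
  exact mul_pos_iff_of_pos_left hc

/-- **Concavity of the cover gap along segments** (the norm is convex, the inner product linear): the gap at a
convex combination is at least the convex combination of the gaps. -/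
theorem coverGap_segment_ge {P : Fin 3 → ℤ} (x x' : EuclideanSpace ℝ (Fin 3)) {t : ℝ} (h0 : 0 ≤ t) (h1 : t ≤ 1) :
    (1 - t) * coverGap P x + t * coverGap P x' ≤ coverGap P ((1 - t) • x + t • x') := by
  unfold coverGap
  have hn : ‖(1 - t) • x + t • x'‖ ≤ (1 - t) * ‖x‖ + t * ‖x'‖ := by
    calc ‖(1 - t) • x + t • x'‖ ≤ ‖(1 - t) • x‖ + ‖t • x'‖ := norm_add_le _ _
      _ = (1 - t) * ‖x‖ + t * ‖x'‖ := by
        rw [norm_smul, norm_smul, Real.norm_of_nonneg h0, Real.norm_of_nonneg (by linarith)]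
  rw [inner_add_left, real_inner_smul_left, real_inner_smul_left]
  have hg : 0 ≤ ‖hcpPt P‖ ^ 2 := sq_nonneg _
  nlinarith [mul_le_mul_of_nonneg_left hn hg]

/-- Positivity of the cover gap is preserved along segments. -/
theorem coverGap_pos_segment {P : Fin 3 → ℤ} {x x' : EuclideanSpace ℝ (Fin 3)} (hx : 0 < coverGap P x)
    (hx' : 0 < coverGap P x') {t : ℝ} (h0 : 0 ≤ t) (h1 : t ≤ 1) : 0 < coverGap P ((1 - t) • x + t • x') := by
  have h := coverGap_segment_ge (P := P) x x' h0 h1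
  rcases eq_or_lt_of_le h0 with rfl | ht
  · simp at h ⊢; linarith
  · nlinarith [mul_nonneg (by linarith : (0:ℝ) ≤ 1 - t) hx.le, mul_pos ht hx']

/-- Positivity of the cover gap at the ends of a parameter interval propagates along an AFFINE path. -/
theorem coverGap_pos_of_affine {P : Fin 3 → ℤ} (f : ℝ → EuclideanSpace ℝ (Fin 3))
    (hf : ∀ t a₀ a₁ : ℝ, f ((1 - t) * a₀ + t * a₁) = (1 - t) • f a₀ + t • f a₁) {a₀ a₁ a : ℝ} (ha₀ : a₀ ≤ a)
    (ha₁ : a ≤ a₁) (h₀ : 0 < coverGap P (f a₀)) (h₁ : 0 < coverGap P (f a₁)) : 0 < coverGap P (f a) := by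
  rcases eq_or_lt_of_le (ha₀.trans ha₁) with hEq | hlt
  · have : a = a₀ := le_antisymm (hEq ▸ ha₁) ha₀
    rw [this]; exact h₀
  · set t := (a - a₀) / (a₁ - a₀) with ht
    have hden : 0 < a₁ - a₀ := by linarith
    have hta : a = (1 - t) * a₀ + t * a₁ := by rw [ht]; field_simp; ring
    have ht0 : 0 ≤ t := div_nonneg (by linarith) hden.le
    have ht1 : t ≤ 1 := by rw [ht, div_le_one hden]; linarith
    rw [hta, hf]
    exact coverGap_pos_segment h₀ h₁ ht0 ht1

/-- Interpolation in the first free coordinate of a face rectangle. -/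
theorem coverGap_pos_faceVec_of_mem_a {P : Fin 3 → ℤ} (i : Fin 3) (c a₀ a₁ b a : ℝ) (ha₀ : a₀ ≤ a)
    (ha₁ : a ≤ a₁) (h₀ : 0 < coverGap P (faceVec i c a₀ b)) (h₁ : 0 < coverGap P (faceVec i c a₁ b)) :
    0 < coverGap P (faceVec i c a b) :=
  coverGap_pos_of_affine (fun a => faceVec i c a b) (fun t a₀ a₁ => faceVec_segment_a i c a₀ a₁ b t) ha₀ ha₁ h₀ h₁

/-- Interpolation in the second free coordinate of a face rectangle. -/
theorem coverGap_pos_faceVec_of_mem_b {P : Fin 3 → ℤ} (i : Fin 3) (c a b₀ b₁ b : ℝ) (hb₀ : b₀ ≤ b)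
    (hb₁ : b ≤ b₁) (h₀ : 0 < coverGap P (faceVec i c a b₀)) (h₁ : 0 < coverGap P (faceVec i c a b₁)) :
    0 < coverGap P (faceVec i c a b) :=
  coverGap_pos_of_affine (fun b => faceVec i c a b) (fun t b₀ b₁ => faceVec_segment_b i c a b₀ b₁ t) hb₀ hb₁ h₀ h₁

/-- **The corner test is sound**: `cornerOK v P ⇒` the direction of `intVec v` is covered by `hcpPt P`. -/
theorem coverGap_pos_of_cornerOK {v P : Fin 3 → ℤ} (h : cornerOK v P = true) : 0 < coverGap P (intVec v) := by
  unfold cornerOK at h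
  simp only [Bool.and_eq_true, decide_eq_true_eq] at h
  obtain ⟨hd, hq⟩ := h
  unfold coverGap
  rw [norm_hcpPt_sq, inner_hcpPt_right]
  simp only [intVec_apply]
  -- names: d = ⟪v,P⟫, N = |P|², W = ‖intVec v‖ (W² = |v|²), r = 1/√18
  set d : ℝ := (v 0 : ℝ) * P 0 + v 1 * P 1 + v 2 * P 2 with hdv
  have hdd : ((dotZ v P : ℤ) : ℝ) = d := by simp only [dotZ, hdv]; push_cast; ring
  set N : ℝ := ((dotZ P P : ℤ) : ℝ) with hN
  set W : ℝ := ‖intVec v‖ with hW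
  have hWsq : W ^ 2 = ((dotZ v v : ℤ) : ℝ) := by
    rw [hW, ← real_inner_self_eq_norm_sq, real_inner_intVec_coords]
    simp only [intVec_apply, dotZ]; push_cast; ring
  have hd0 : 0 < d := by rw [← hdd]; exact_mod_cast hd
  have hq' : N * N * W ^ 2 < 72 * (d * d) := by
    rw [hWsq, hN, ← hdd]; exact_mod_cast hq
  have hN0 : 0 ≤ N := by
    have : (0 : ℤ) ≤ dotZ P P := by unfold dotZ; nlinarith [sq_nonneg (P 0), sq_nonneg (P 1), sq_nonneg (P 2)]
    rw [hN]; exact_mod_cast this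
  have hW0 : 0 ≤ W := norm_nonneg _
  set r : ℝ := (Real.sqrt 18)⁻¹ with hr
  have hr0 : 0 < r := by rw [hr]; positivity
  have hrr : r * r = 1 / 18 := by
    rw [hr, ← mul_inv, Real.mul_self_sqrt (by norm_num : (0:ℝ) ≤ 18), one_div]
  -- (N W r)² = N² W² / 18 < 4 d²  ⇒  N W r < 2 d
  have h1 : (N * W * r) * (N * W * r) < (2 * d) * (2 * d) := by
    have : (N * W * r) * (N * W * r) = N * N * W ^ 2 * (r * r) := by ring
    rw [this, hrr]
    nlinarith [hq']
  have h2 : N * W * r < 2 * d := by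
    by_contra hcon
    push Not at hcon
    nlinarith [mul_le_mul hcon hcon (by positivity) (by positivity)]
  have h3 : N / 18 * W = N * W * r * r := by
    rw [mul_assoc (N * W), hrr]; ring
  rw [h3]
  nlinarith [mul_lt_mul_of_pos_right h2 hr0]

/-! ### Soundness of the tree checker -/

/-- Rescaling step of the tree soundness: the child rectangle's point at scale `2D` is twice the parent's. -/
theorem coverGap_pos_of_double {P : Fin 3 → ℤ} (i : Fin 3) (s D : ℤ) (a b : ℝ)
    (hg : 0 < coverGap P (faceVec i ((s * (2 * D) : ℤ) : ℝ) (2 * a) (2 * b))) :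
    0 < coverGap P (faceVec i ((s * D : ℤ) : ℝ) a b) := by
  have hsc : ((s * (2 * D) : ℤ) : ℝ) = 2 * ((s * D : ℤ) : ℝ) := by push_cast; ring
  rw [hsc, faceVec_two_mul] at hg
  exact (coverGap_pos_smul_iff (by norm_num)).1 hg

/-- **Soundness of `coverTreeCheck`**: every real point of the rectangle (at scale `D`) is covered by some obstacle of `L`. -/
theorem coverTreeCheck_sound (L : List (Fin 3 → ℤ)) (i : Fin 3) (s : ℤ) :
    ∀ (t : CoverTree) (D a0 a1 b0 b1 : ℤ), coverTreeCheck L i s D a0 a1 b0 b1 t = true →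
      ∀ a b : ℝ, (a0 : ℝ) ≤ a → a ≤ a1 → (b0 : ℝ) ≤ b → b ≤ b1 →
        ∃ P ∈ L, 0 < coverGap P (faceVec i ((s * D : ℤ) : ℝ) a b) := by
  intro t
  induction t with
  | leaf n =>
    intro D a0 a1 b0 b1 h a b ha0 ha1 hb0 hb1
    unfold coverTreeCheck at h
    cases hL : L[n]? with
    | none => simp only [hL] at h; exact absurd h Bool.false_ne_true
    | some P =>
      simp only [hL, Bool.and_eq_true] at h
      obtain ⟨⟨⟨h00, h01⟩, h10⟩, h11⟩ := h
      refine ⟨P, List.mem_of_getElem? hL, ?_⟩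
      have g00 := coverGap_pos_of_cornerOK h00; have g01 := coverGap_pos_of_cornerOK h01
      have g10 := coverGap_pos_of_cornerOK h10; have g11 := coverGap_pos_of_cornerOK h11
      rw [intVec_faceVecZ] at g00 g01 g10 g11
      push_cast at g00 g01 g10 g11 ⊢
      exact coverGap_pos_faceVec_of_mem_a i _ _ _ _ _ ha0 ha1
        (coverGap_pos_faceVec_of_mem_b i _ _ _ _ _ hb0 hb1 g00 g01)
        (coverGap_pos_faceVec_of_mem_b i _ _ _ _ _ hb0 hb1 g10 g11)
  | splitA l r ihl ihr =>
    intro D a0 a1 b0 b1 h a b ha0 ha1 hb0 hb1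
    unfold coverTreeCheck at h
    simp only [Bool.and_eq_true] at h
    by_cases hm : 2 * a ≤ ((a0 + a1 : ℤ) : ℝ)
    · obtain ⟨P, hP, hg⟩ := ihl _ _ _ _ _ h.1 (2 * a) (2 * b) (by push_cast; linarith) hm
        (by push_cast; linarith) (by push_cast; linarith)
      exact ⟨P, hP, coverGap_pos_of_double i s D a b hg⟩
    · obtain ⟨P, hP, hg⟩ := ihr _ _ _ _ _ h.2 (2 * a) (2 * b) (by push_cast at hm ⊢; linarith)
        (by push_cast; linarith) (by push_cast; linarith) (by push_cast; linarith)
      exact ⟨P, hP, coverGap_pos_of_double i s D a b hg⟩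
  | splitB l r ihl ihr =>
    intro D a0 a1 b0 b1 h a b ha0 ha1 hb0 hb1
    unfold coverTreeCheck at h
    simp only [Bool.and_eq_true] at h
    by_cases hm : 2 * b ≤ ((b0 + b1 : ℤ) : ℝ)
    · obtain ⟨P, hP, hg⟩ := ihl _ _ _ _ _ h.1 (2 * a) (2 * b) (by push_cast; linarith) (by push_cast; linarith)
        (by push_cast; linarith) hm
      exact ⟨P, hP, coverGap_pos_of_double i s D a b hg⟩
    · obtain ⟨P, hP, hg⟩ := ihr _ _ _ _ _ h.2 (2 * a) (2 * b) (by push_cast; linarith) (by push_cast; linarith)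
        (by push_cast at hm ⊢; linarith) (by push_cast; linarith)
      exact ⟨P, hP, coverGap_pos_of_double i s D a b hg⟩

/-- Every nonzero vector is a positive multiple of a point of one of the six face rectangles. -/
theorem exists_face_of_ne_zero (y : EuclideanSpace ℝ (Fin 3)) (hy : y ≠ 0) :
    ∃ (i : Fin 3) (s : ℤ) (m a b : ℝ), (s = 1 ∨ s = -1) ∧ 0 < m ∧ -1 ≤ a ∧ a ≤ 1 ∧ -1 ≤ b ∧ b ≤ 1 ∧
      y = m • faceVec i (s : ℝ) a b := by
  obtain ⟨i, -, hi⟩ := Finset.exists_max_image Finset.univ (fun k => |y k|) ⟨0, Finset.mem_univ _⟩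
  replace hi : ∀ k, |y k| ≤ |y i| := fun k => hi k (Finset.mem_univ k)
  have hm0 : 0 < |y i| := by
    rcases (abs_nonneg (y i)).eq_or_lt with h | h
    · exfalso; apply hy
      ext k
      have hk : y k = 0 := abs_nonpos_iff.1 (by linarith [hi k])
      simpa using hk
    · exact h
  have hdiv : ∀ k, -1 ≤ y k / |y i| ∧ y k / |y i| ≤ 1 := by
    intro k
    constructor
    · rw [le_div_iff₀ hm0]; linarith [neg_abs_le (y k), hi k]
    · rw [div_le_iff₀ hm0]; linarith [le_abs_self (y k), hi k]
  have hmk : ∀ k, |y i| * (y k / |y i|) = y k := fun k => mul_div_cancel₀ _ hm0.ne'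
  -- the sign
  obtain ⟨s, hs1, hsm⟩ : ∃ s : ℤ, (s = 1 ∨ s = -1) ∧ |y i| * (s : ℝ) = y i := by
    by_cases h : 0 ≤ y i
    · exact ⟨1, Or.inl rfl, by push_cast; rw [abs_of_nonneg h, mul_one]⟩
    · exact ⟨-1, Or.inr rfl, by push_cast; rw [abs_of_neg (not_le.1 h)]; ring⟩
  fin_cases i
  · refine ⟨0, s, |y 0|, y 1 / |y 0|, y 2 / |y 0|, hs1, hm0, (hdiv 1).1, (hdiv 1).2, (hdiv 2).1, (hdiv 2).2, ?_⟩
    ext k; fin_cases k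
    · simp [faceVec]; exact hsm.symm
    · simp [faceVec]; exact (hmk 1).symm
    · simp [faceVec]; exact (hmk 2).symm
  · refine ⟨1, s, |y 1|, y 0 / |y 1|, y 2 / |y 1|, hs1, hm0, (hdiv 0).1, (hdiv 0).2, (hdiv 2).1, (hdiv 2).2, ?_⟩
    ext k; fin_cases k
    · simp [faceVec]; exact (hmk 0).symm
    · simp [faceVec]; exact hsm.symm
    · simp [faceVec]; exact (hmk 2).symm
  · refine ⟨2, s, |y 2|, y 0 / |y 2|, y 1 / |y 2|, hs1, hm0, (hdiv 0).1, (hdiv 0).2, (hdiv 1).1, (hdiv 1).2, ?_⟩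
    ext k; fin_cases k
    · simp [faceVec]; exact (hmk 0).symm
    · simp [faceVec]; exact (hmk 1).symm
    · simp [faceVec]; exact hsm.symm

/-- **Soundness of `coverCheck`**: the unit sphere is covered by the open unit balls around `hcpPt '' L`. -/
theorem sphere_covered_of_coverCheck {L : List (Fin 3 → ℤ)} {t0p t0m t1p t1m t2p t2m : CoverTree}
    (h : coverCheck L t0p t0m t1p t1m t2p t2m = true) (y : EuclideanSpace ℝ (Fin 3)) (hy : ‖y‖ = 1) :
    ∃ P ∈ L, dist y (hcpPt P) < 1 := by
  have hy0 : y ≠ 0 := by intro h0; rw [h0, norm_zero] at hy; exact zero_ne_one hy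
  obtain ⟨i, s, m, a, b, hs, hm, ha0, ha1, hb0, hb1, hyv⟩ := exists_face_of_ne_zero y hy0
  unfold coverCheck at h
  simp only [Bool.and_eq_true] at h
  obtain ⟨⟨⟨⟨⟨h0p, h0m⟩, h1p⟩, h1m⟩, h2p⟩, h2m⟩ := h
  have key : ∀ (t : CoverTree), coverTreeCheck L i s 1 (-1) 1 (-1) 1 t = true → ∃ P ∈ L, dist y (hcpPt P) < 1 := by
    intro t ht
    obtain ⟨P, hP, hg⟩ := coverTreeCheck_sound L i s t 1 (-1) 1 (-1) 1 ht a b (by push_cast; linarith)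
      (by push_cast; linarith) (by push_cast; linarith) (by push_cast; linarith)
    refine ⟨P, hP, dist_lt_one_of_coverGap_pos hy ?_⟩
    rw [hyv]
    have : ((s * 1 : ℤ) : ℝ) = (s : ℝ) := by push_cast; ring
    rw [this] at hg
    exact (coverGap_pos_smul_iff hm).2 hg
  fin_cases i <;> rcases hs with rfl | rfl
  · exact key _ h0p
  · exact key _ h0m
  · exact key _ h1p
  · exact key _ h1m
  · exact key _ h2p
  · exact key _ h2m

end Summit.Ventures.Crystal3D.Theorems

end
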